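import HarnessLib.Audit.LibrarySuggestionsDenyListCorCM
import Summits.HodgeConjecture.CorCM.HypLiu418.A3Liu418GSInstance
import Literature.NumberTheory.Automorphic.Liu2021.AppendixC.HeckeTranslateLevelQuotient
import HarnessLib

/-!
# The level projections and the normal-sub-level translates of the GS unitary Shimura CURVE tower are FINITE-GROUP QUOTIENTS,
# over `F` and after complexification — the (iv-b) inputs for the three cover families `u`, `q′`, `u″` of the `stub_RosH` glue

Cell `hodgecm-mathlib` (D-0151), crux `HLiu418` = stmt-HodgeConjecture-24832, d6 line `Cruxes/HLiu418/Lines/d6_cm_curve`, socket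
`SocketRosH`, glue file `A3Liu418GSRosH.lean` (pen A-p02 (g14)); hand (O-e) of A-plan2 (g12) 2026-08-30T05:16Z, (L3) ENTRY RECIPE of record.
BARE PROOF FILE: theorems only — no definition ∕ structure ∕ instance ∕ named fact ∕ `sorry`; count-neutral: HC_CM is proved only modulo the
7 printed citations until rung 0 closes.

Everything is ★ `Liu2021/AppendixC/HeckeTranslateLevelQuotient` (generic over a §4.2 datum with Hecke translates, fed by the level-quotient
universal property) applied to the GS datum `C := sec42DataGS S h4 isoₛ` (`X⋆_K = M_K ⊗_{F,c} F`), its CHOSEN translates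
`T := sec42HeckeTranslatesGS S hU7ₛ h4 isoₛ` (u1 `hU7ₛ`) and ★ `levelQuotientUP_GS` (u4 `hLQ` transported along `– ⊗_c F`):

* `exists_finite_isSepQuotient_map_GS` — `u^N_K : X⋆_N → X⋆_K` (`N ≤ K`, `N ⊴ K`) is a quotient of `X⋆_N` by a FINITE group for separated
  test objects (`Motives.IsSepQuotient`);
* **`exists_finite_isSepQuotient_tr_GS`** — for `N″ ⊴ K`, `γ⁻¹Nγ ⊆ K`, `γN″γ⁻¹ ⊆ N`: the translate `q′ = T⋆_{γ⁻¹} : X⋆_{N″} → X⋆_N` is a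
  quotient by a finite group AND `q′ ≫ T⋆_γ = u″ : X⋆_{N″} → X⋆_K` (the domination of the `T_γ`-letter);
* `…_GS_complex` (both) — the same after base change along `algebraMap F ℂ` for the ambient `[Algebra (F : Type) ℂ]` of the frame, in
  the spelling `baseChangeHom (algebraMap F ℂ)` (= the frame's `AbelianVariety.bcFunctor F ℂ`: both are
  `Over.pullback (Spec.map (algebraMap F ℂ))`), with the separatedness of the complexified target — verbatim the `act`, `hp`, `hY` that
  ★ `Motives.exists_subgroup_isSepQuotient_pieceMap'` consumes at the complex pieces of the (M) models (★ `AlbaneseComplexJacobianModel`).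

## References
* [Milne2005ShimuraVarieties] J. S. Milne, *Introduction to Shimura varieties* (2005), §5 p. 57 L7–12, p. 58 L3–11, Rem. 5.29 (c) p. 65;
  §13 p. 118 L21–26.
* [Deligne1979ShimuraVarieties] P. Deligne, *Variétés de Shimura*, Proc. Symp. Pure Math. 33 (1979), 2.7.1 (b)–(c), 2.1.2.
* [MumfordAV1970] D. Mumford, *Abelian Varieties* (1970), §7 Thm. p. 66 and Remark.
* [SGA1] A. Grothendieck, *SGA 1*, Exp. V §1 Prop. 1.1, 1.8.
-/

set_option autoImplicit false

noncomputable section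

open CategoryTheory CategoryTheory.Limits AlgebraicGeometry NumberField
open Literature.AlgebraicGeometry.Motives
open Literature.AlgebraicGeometry.ShimuraVarieties.UnitaryCanonicalModel
open Literature.NumberTheory.Automorphic Literature.NumberTheory.Automorphic.UnitaryGroup
open Literature.NumberTheory.Automorphic.Liu2021 Literature.NumberTheory.Automorphic.Liu2021.AppendixC

namespace Summit.HodgeConjecture.CorCM.Lines.A3Liu418

variable {F : CMField} {ι₁ : F →+* ℂ} {Jstar : Matrix (Fin 2) (Fin 2) F}
  {K₀ : C5.OpenCompactSubgroup ↥(finAdelic (↥(maximalRealSubfield F)) F (IsCMField.complexConj F) 2 Jstar)}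
  (S : RecordSystemGS F Jstar ι₁ K₀)
  (hU7ₛ : S.HeckeTranslateDefinedOver) (hLQ : S.IsLevelQuotient) (h4 : 4 ≤ Module.finrank ℚ F) (isoₛ : ℕ → Prop)

/-! ## Over `F` -/

include hU7ₛ hLQ in
/-- **`u^N_K : X⋆_N → X⋆_K` (`N ≤ K`, `N ⊴ K`) is a quotient of `X⋆_N` by a FINITE group for separated test objects** (the finite group
`K ∕ N` acting by the chosen translates `T⋆_{k⁻¹}`): ★ `HeckeTranslates.exists_finite_isSepQuotient_map` fed by ★ `levelQuotientUP_GS`.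
[cite: Milne2005ShimuraVarieties, §5 p. 57 L7–12 and Rem. 5.29 (c) p. 65] [cite: Deligne1979ShimuraVarieties, 2.7.1 (b)–(c)] -/
theorem exists_finite_isSepQuotient_map_GS ⦃N K : C5.SmallLevel K₀⦄ (hNK : N ≤ K) (hn : ∀ k ∈ K.1.1, C5.HeckeLE k N N) :
    ∃ (Δ : Type) (_ : Group Δ) (_ : Fintype Δ) (act : Δ →* Aut ((sec42DataGS S h4 isoₛ).X N)),
      IsSepQuotient (fun δ => act δ) ((sec42DataGS S h4 isoₛ).cpt.X.map (homOfLE hNK)) :=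
  (sec42HeckeTranslatesGS S hU7ₛ h4 isoₛ).exists_finite_isSepQuotient_map hNK hn (levelQuotientUP_GS S hU7ₛ hLQ h4 isoₛ hNK hn)

include hLQ in
/-- **The translate `q′ = T⋆_{γ⁻¹} : X⋆_{N″} → X⋆_N` is a quotient of `X⋆_{N″}` by a FINITE group, and `q′ ≫ T⋆_γ = u″ : X⋆_{N″} → X⋆_K`**,
for `N″ ⊴ K`, `N″ ≤ K`, `γ⁻¹Nγ ⊆ K`, `γN″γ⁻¹ ⊆ N` — the dominating Galois cover of the `T_γ`-letter in the (L3) entry recipe: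
★ `HeckeTranslates.exists_finite_isSepQuotient_translate` fed by ★ `levelQuotientUP_GS` at every normal level pair.
[cite: Milne2005ShimuraVarieties, §5 p. 58 L3–11 and §13 p. 118 L21–26] [cite: MumfordAV1970, §7 Thm. p. 66 (Remark)] -/
theorem exists_finite_isSepQuotient_tr_GS
    (γ : ↥(finAdelic (↥(maximalRealSubfield F)) F (IsCMField.complexConj F) 2 Jstar)) ⦃N'' N K : C5.SmallLevel K₀⦄
    (hn'' : ∀ k ∈ K.1.1, C5.HeckeLE k N'' N'') (hle : N'' ≤ K) (hγ : C5.HeckeLE γ N K) (h : C5.HeckeLE γ⁻¹ N'' N) :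
    ∃ (Δ : Type) (_ : Group Δ) (_ : Fintype Δ) (act : Δ →* Aut ((sec42DataGS S h4 isoₛ).X N'')),
      IsSepQuotient (fun δ => act δ) ((sec42HeckeTranslatesGS S hU7ₛ h4 isoₛ).tr γ⁻¹ N'' N h) ∧
      (sec42HeckeTranslatesGS S hU7ₛ h4 isoₛ).tr γ⁻¹ N'' N h ≫ (sec42HeckeTranslatesGS S hU7ₛ h4 isoₛ).tr γ N K hγ =
        (sec42DataGS S h4 isoₛ).cpt.X.map (homOfLE hle) :=
  (sec42HeckeTranslatesGS S hU7ₛ h4 isoₛ).exists_finite_isSepQuotient_translate γ hn'' hle hγ h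
    (levelQuotientUP_GS S hU7ₛ hLQ h4 isoₛ)

/-! ## After complexification (`baseChangeHom (algebraMap F ℂ)` = the frame's `bcFunctor F ℂ`) -/

include hU7ₛ hLQ in
/-- **`(u^N_K)_ℂ` is a quotient of `(X⋆_N)_ℂ` by a finite group and `(X⋆_K)_ℂ` is separated**, for the ambient `[Algebra F ℂ]`: ★
`HeckeTranslates.exists_finite_isSepQuotient_map_baseChange` at `τ := algebraMap F ℂ` — the `act`∕`hp`∕`hY` of ★
`exists_subgroup_isSepQuotient_pieceMap'` at the complex pieces of the level cover `u`. [cite: SGA1, Exp. V §1 Prop. 1.1, 1.8]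
[cite: Milne2005ShimuraVarieties, Rem. 5.29 (c) p. 65] -/
theorem exists_finite_isSepQuotient_map_GS_complex [Algebra (F : Type) ℂ] ⦃N K : C5.SmallLevel K₀⦄ (hNK : N ≤ K)
    (hn : ∀ k ∈ K.1.1, C5.HeckeLE k N N) :
    ∃ (Δ : Type) (_ : Group Δ) (_ : Fintype Δ) (act : Δ →* Aut ((sec42DataGS S h4 isoₛ).X N)),
      IsSepQuotient (fun δ => act δ) ((sec42DataGS S h4 isoₛ).cpt.X.map (homOfLE hNK)) ∧
      IsSeparated ((baseChangeHom (algebraMap (F : Type) ℂ)).obj ((sec42DataGS S h4 isoₛ).X K)).hom ∧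
      IsSepQuotient (fun δ => (baseChangeHom (algebraMap (F : Type) ℂ)).mapIso (act δ))
        ((baseChangeHom (algebraMap (F : Type) ℂ)).map ((sec42DataGS S h4 isoₛ).cpt.X.map (homOfLE hNK))) :=
  (sec42HeckeTranslatesGS S hU7ₛ h4 isoₛ).exists_finite_isSepQuotient_map_baseChange (algebraMap (F : Type) ℂ) hNK hn
    (levelQuotientUP_GS S hU7ₛ hLQ h4 isoₛ hNK hn)

include hLQ in
/-- **`(T⋆_{γ⁻¹})_ℂ : (X⋆_{N″})_ℂ → (X⋆_N)_ℂ` is a quotient of `(X⋆_{N″})_ℂ` by a finite group**, `(X⋆_N)_ℂ` is separated, and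
`(T⋆_{γ⁻¹})_ℂ ≫ (T⋆_γ)_ℂ = (u″)_ℂ` — the `act`∕`hp`∕`hY` of ★ `exists_subgroup_isSepQuotient_pieceMap'` at the complex pieces for the `q′`-letters,
with the domination `q′ ≫ T_γ = u″`. [cite: SGA1, Exp. V §1 Prop. 1.1, 1.8] [cite: Milne2005ShimuraVarieties, §13 p. 118 L21–26]
[cite: MumfordAV1970, §7 Thm. p. 66 (Remark)] -/
theorem exists_finite_isSepQuotient_tr_GS_complex [Algebra (F : Type) ℂ]
    (γ : ↥(finAdelic (↥(maximalRealSubfield F)) F (IsCMField.complexConj F) 2 Jstar)) ⦃N'' N K : C5.SmallLevel K₀⦄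
    (hn'' : ∀ k ∈ K.1.1, C5.HeckeLE k N'' N'') (hle : N'' ≤ K) (hγ : C5.HeckeLE γ N K) (h : C5.HeckeLE γ⁻¹ N'' N) :
    ∃ (Δ : Type) (_ : Group Δ) (_ : Fintype Δ) (act : Δ →* Aut ((sec42DataGS S h4 isoₛ).X N'')),
      IsSepQuotient (fun δ => act δ) ((sec42HeckeTranslatesGS S hU7ₛ h4 isoₛ).tr γ⁻¹ N'' N h) ∧
      IsSeparated ((baseChangeHom (algebraMap (F : Type) ℂ)).obj ((sec42DataGS S h4 isoₛ).X N)).hom ∧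
      IsSepQuotient (fun δ => (baseChangeHom (algebraMap (F : Type) ℂ)).mapIso (act δ))
        ((baseChangeHom (algebraMap (F : Type) ℂ)).map ((sec42HeckeTranslatesGS S hU7ₛ h4 isoₛ).tr γ⁻¹ N'' N h)) ∧
      (baseChangeHom (algebraMap (F : Type) ℂ)).map ((sec42HeckeTranslatesGS S hU7ₛ h4 isoₛ).tr γ⁻¹ N'' N h) ≫
          (baseChangeHom (algebraMap (F : Type) ℂ)).map ((sec42HeckeTranslatesGS S hU7ₛ h4 isoₛ).tr γ N K hγ) =
        (baseChangeHom (algebraMap (F : Type) ℂ)).map ((sec42DataGS S h4 isoₛ).cpt.X.map (homOfLE hle)) :=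
  (sec42HeckeTranslatesGS S hU7ₛ h4 isoₛ).exists_finite_isSepQuotient_translate_baseChange (algebraMap (F : Type) ℂ) γ hn''
    hle hγ h (levelQuotientUP_GS S hU7ₛ hLQ h4 isoₛ)

end Summit.HodgeConjecture.CorCM.Lines.A3Liu418

end
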